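import Summits.QuantumFields.BalabanUV.T4Continuum.Spine.NE9.DirectPairingRunLimitSharp

/-!
# T⁴ programme, spine estimate NE9 — NODE U5b ON THE TOWER OF CARRIERS, BY NAME: the SAME qualitative E-side list that serves node U3 → U6
# in King's currency (tower-NE5 + prefix dependence + per-scale separate uniform continuity, or locality∕shapes∕κ-loss + per-run joint
# continuity + stabilisation) gives node U5b's UNIFORM BRACKET on the carriers — histories δ-close below the scale ⇒ terms `η·e^{−κd}`-close,
# uniformly in the run, the scale, the background and the domain — with NO fading memory, NO moduli, NO row sums; and the run-uniformity
# is load-bearing for U5b too — census items C32∕C35 (carriers level) of cell `pub-balaban-gaps`, seat ne9 (gen 8)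

Cell `pub-balaban-gaps` (YM blitz G2, seat ne9, unit `pub-balaban-gaps-ne9-g8`; record `run/shared/lean/pub/pub-balaban-gaps/ne/NE9.md` §5 rows
C32∕C35).  Summits-side bookkeeping; real analysis on hypothesis SHAPES over gen 4's `TowerCarriers.TowerData`; no definition; nothing of
Bałaban's asserted.

WHY.  NE9 has TWO consumers in the spine: node U3 → U6 (the Cauchy sum; King's currency: `TowerCarriersKing`, `DirectPairingLocality`,
`DirectPairingRunLimit`) and node U5b, which consumes only a bracket bound UNIFORM IN THE SCALE from uniform closeness of the coupling histories
— the role of `T4OutputRate.historySum_le_of_fadingMemory` (`Σ_{i<j} Λ j i |g^A_i − g^B_i| ≤ C₉D(1−ω)⁻¹` under `FadingMemory`).  Gen 6 typed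
the U5b currency at the FAMILY level (`DirectPairingFamily.uniformSmall_family`, C32: uniform equicontinuity in the sup-distance of histories);
gens 6–8 put the U6 side on the carriers BY NAME.  This file puts the U5b side on the carriers by name, from the same inputs, so that BOTH
consumers of NE9 are served on the tower of carriers by one qualitative E-side list:
* §1 **`uniformSmall_carriers`** — `TowerNE5On` + prefix dependence + the carriers-level `hUC` of `TowerCarriersKing` ⇒ ∀ `η > 0` ∃ `δ > 0`:
  for EVERY run `k`, background `U`, domain `X` (`r X ≤ k`) and admissible `g, g'` with `|g_i − g'_i| ≤ δ` below the scale `k − r X`,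
  `|E k g U X − E k g' U X| ≤ η·e^{−κd(X)}` (via `uniformSmall_family` on the sections `TowerCarriersKing.kingSection`).
* §2 **`uniformSmall_carriers_of_shapes`** (at `κ' < κ`, from per-shape moduli + (S) + (B) + (K): `DirectPairingLocality.sepUC_of_shapes`) and
  **`uniformSmall_carriers_of_stabilising_shapes`** (from per-shape compact local data + per-run joint continuity + stabilisation in the run:
  `DirectPairingRunLimit.sepUCshape_of_stabilising`).
* §3 NECESSITY of the run-uniformity for U5b as well: on the run tower of `DirectPairingRunLimitSharp` (tower-NE5, prefix dependence, bound and
  EVERY per-run modulus in force) the U5b conclusion FAILS (`runTerm_not_uniformSmall`: domain `n` in run `n + 1`, youngest couplings `δ`-close,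
  terms `2` apart once `(n+1)δ ≥ π`).

VERDICT FOR THE ROW (bookkeeping): both consumers of NE9 (U3 → U6 in King's currency, U5b) are fed on the carriers BY NAME from {tower-NE5,
prefix dependence, per-run joint continuity of the local terms in (young couplings, compact local datum), locality∕finite shapes∕(1.18) + κ-loss,
volume-uniformity at fixed shape (exact locality ∕ stabilisation ∕ volume-uniform modulus)} — no `FadingMemory`, no moduli family `Λ`, no
constant; each clause a property of ONE renormalization step (W1).  Classification of NE9 UNCHANGED in kind (WORK-bound on W1; instance 0∕1).

HONEST FRAMING: bookkeeping for rung (B)+1 on ONE FIXED finite four-torus; tower-NE5 is the cell's estimate NE5 (NOT PRINTED, NOT PROVED);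
NE9 NOT PRINTED ∕ NOT PROVED; spine PROVED 0∕9 unchanged; NOT UV stability, NOT the continuum limit, NOT infinite volume, NOT a mass gap,
NOT Clay.

References (TYPES only): [Balaban1987RG1] = T. Bałaban, Commun. Math. Phys. **109** (1987) 249–301, Thm 1 p. 259, p. 263, §5 p. 298;
[King1986] = C. King, Commun. Math. Phys. **102** (1986) 649–677, §3.2 pp. 656–657.
-/

namespace Summit.QuantumFields.BalabanUV.T4Continuum.NE9.DirectPairingUniformCarriers

open scoped BigOperators
open Finset Filter Topology Metric Set
open Literature.MathematicalPhysics.QuantumFieldTheory.Balaban1983to89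
open Literature.MathematicalPhysics.QuantumFieldTheory.Balaban1983to89.T4CouplingAnalyticity (BoxWindow)
open Summit.QuantumFields.BalabanUV.T4Continuum.NE9.TowerCarriers
open Summit.QuantumFields.BalabanUV.T4Continuum.NE9.TowerCarriersBox
  (TowerNE5On shift_mem_boxWindow mix_mem_boxWindow)
open Summit.QuantumFields.BalabanUV.T4Continuum.NE9.TowerCarriersKing
  (kingSection kingSection_of_le kingSection_rate kingSection_prefix kingSection_sepUC)
open Summit.QuantumFields.BalabanUV.T4Continuum.NE9.DirectPairingFamily (uniformSmall_family)
open Summit.QuantumFields.BalabanUV.T4Continuum.NE9.DirectPairingLocality (towerNE5On_mono_kappa sepUC_of_shapes)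
open Summit.QuantumFields.BalabanUV.T4Continuum.NE9.DirectPairingRunLimit (sepUCshape_of_stabilising)
open Summit.QuantumFields.BalabanUV.T4Continuum.NE9.DirectPairingRunLimitSharp
  (runTower runTerm runTerm_of_lt sin_pair)

variable (T : TowerData) {E : ℕ → (ℕ → ℝ) → T.B → T.Dom → ℝ} {I : Set ℝ} {κ κ' : ℝ}

/-! ## §1 Node U5b's uniform bracket on the carriers -/

/-- **NODE U5b ON THE CARRIERS (E-side END, by name).**  `TowerNE5On T E I κ θ C₅` (`C₅ ≥ 0`, `0 ≤ θ < 1`) + prefix dependence + the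
carriers-level separate uniform continuity `hUC` of `TowerCarriersKing` (per scale `m` and coordinate `i < m`, one `δ` for every run,
background and domain of that scale) ⇒ for every `η > 0` ONE `δ > 0` such that for ALL runs `k`, backgrounds `U`, domains `X` with `r X ≤ k`
and admissible histories `δ`-close below the scale, `|E k g U X − E k g' U X| ≤ η·e^{−κd(X)}` — the uniform-in-the-scale bracket node U5b
consumes (`T4OutputRate.historySum_le_of_fadingMemory`'s role), with NO fading memory, NO moduli, NO row sums: uniform δ-closeness in,
uniform η-closeness out.  Proof: `DirectPairingFamily.uniformSmall_family` on the sections `kingSection`. [folklore] -/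
theorem uniformSmall_carriers {θ C₅ : ℝ} (hC : 0 ≤ C₅) (hθ0 : 0 ≤ θ) (hθ1 : θ < 1)
    (h5 : TowerNE5On T E I κ θ C₅)
    (hP : ∀ (k : ℕ) (U : T.B) (X : T.Dom), ∀ g ∈ BoxWindow I, ∀ g' ∈ BoxWindow I,
      (∀ i, i < k - T.r X → g i = g' i) → E k g U X = E k g' U X)
    (hUC : ∀ m i : ℕ, i < m → ∀ ε : ℝ, 0 < ε → ∃ δ : ℝ, 0 < δ ∧ ∀ (k : ℕ) (U : T.B) (X : T.Dom), T.r X + m = k →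
      ∀ g ∈ BoxWindow I, ∀ g' ∈ BoxWindow I, (∀ j, j ≠ i → g j = g' j) → |g i - g' i| ≤ δ →
        Real.exp (κ * T.d X) * |E k g U X - E k g' U X| ≤ ε)
    {η : ℝ} (hη : 0 < η) :
    ∃ δ : ℝ, 0 < δ ∧ ∀ (k : ℕ) (U : T.B) (X : T.Dom), T.r X ≤ k →
      ∀ g ∈ BoxWindow I, ∀ g' ∈ BoxWindow I, (∀ i, i < k - T.r X → |g i - g' i| ≤ δ) →
        |E k g U X - E k g' U X| ≤ η * Real.exp (-(κ * T.d X)) := by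
  obtain ⟨δ, hδ, hM⟩ := uniformSmall_family (σ := ℕ × T.B × T.Dom) (W := BoxWindow I)
    (F := fun s => kingSection T E κ s.1 s.2.1 s.2.2) hC hθ0 hθ1
    (fun g hg => shift_mem_boxWindow hg) (fun g hg g' hg' a => mix_mem_boxWindow hg hg' a)
    (fun s => kingSection_rate T hC hθ0 h5 s.1 s.2.1 s.2.2) (fun s => kingSection_prefix T hP s.1 s.2.1 s.2.2)
    (kingSection_sepUC T hUC) hη
  refine ⟨δ, hδ, fun k U X hX g hg g' hg' hgg' => ?_⟩
  have h := hM (k, U, X) (k - T.r X) g hg g' hg' hgg'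
  dsimp only at h
  rw [kingSection_of_le T hX le_rfl, kingSection_of_le T hX le_rfl, show T.r X + (k - T.r X) = k by omega, T.descend_top,
    ← mul_sub, abs_mul, abs_of_pos (Real.exp_pos _)] at h
  have h2 := (le_div_iff₀' (Real.exp_pos _)).mpr h
  rwa [div_eq_mul_inv, ← Real.exp_neg] at h2

/-! ## §2 The same from per-shape moduli with a κ-loss, and from per-run continuity + stabilisation -/

/-- **NODE U5b ON THE CARRIERS FROM PER-SHAPE MODULI** (at `κ' < κ`): tower-NE5 at `κ` + prefix dependence + finitely many shapes below
every tree length + the (1.18)-type bound + per-shape moduli at `κ` (`DirectPairingLocality.sepUC_of_shapes`) ⇒ the uniform bracket of §1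
in the weight `e^{−κ'd}`. [folklore] -/
theorem uniformSmall_carriers_of_shapes {θ C₅ B : ℝ} {Sh : Type*} (sh : T.Dom → Sh) (dS : Sh → ℝ)
    (hd : ∀ X, T.d X = dS (sh X)) (hfin : ∀ D : ℝ, {σ | dS σ ≤ D}.Finite)
    (hC : 0 ≤ C₅) (hθ0 : 0 ≤ θ) (hθ1 : θ < 1) (hκ : κ' < κ) (h5 : TowerNE5On T E I κ θ C₅)
    (hP : ∀ (k : ℕ) (U : T.B) (X : T.Dom), ∀ g ∈ BoxWindow I, ∀ g' ∈ BoxWindow I,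
      (∀ i, i < k - T.r X → g i = g' i) → E k g U X = E k g' U X)
    (hB : ∀ (k : ℕ) (U : T.B) (X : T.Dom), ∀ g ∈ BoxWindow I, Real.exp (κ * T.d X) * |E k g U X| ≤ B)
    (hUCσ : ∀ (σ : Sh) (m i : ℕ), i < m → ∀ ε : ℝ, 0 < ε → ∃ δ : ℝ, 0 < δ ∧ ∀ (k : ℕ) (U : T.B) (X : T.Dom), sh X = σ →
      T.r X + m = k → ∀ g ∈ BoxWindow I, ∀ g' ∈ BoxWindow I, (∀ j, j ≠ i → g j = g' j) → |g i - g' i| ≤ δ →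
        Real.exp (κ * T.d X) * |E k g U X - E k g' U X| ≤ ε)
    {η : ℝ} (hη : 0 < η) :
    ∃ δ : ℝ, 0 < δ ∧ ∀ (k : ℕ) (U : T.B) (X : T.Dom), T.r X ≤ k →
      ∀ g ∈ BoxWindow I, ∀ g' ∈ BoxWindow I, (∀ i, i < k - T.r X → |g i - g' i| ≤ δ) →
        |E k g U X - E k g' U X| ≤ η * Real.exp (-(κ' * T.d X)) :=
  uniformSmall_carriers T hC hθ0 hθ1 (towerNE5On_mono_kappa T hC hθ0 hκ.le h5) hP
    (sepUC_of_shapes T sh dS hd hfin hB hκ hUCσ) hη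

/-- **NODE U5b ON THE CARRIERS FROM PER-RUN JOINT CONTINUITY + STABILISATION** (at `κ' < κ`): tower-NE5 + prefix dependence + (S) + (B) +
per shape∕scale: compact local data `Kc σ m`, a run-indexed family `Em σ m k` jointly continuous on `[a, b]^m × Kc σ m` (`I ⊆ [a, b]`) which
stabilises in the run, and the factorisation of the normalised term through it (`DirectPairingRunLimit.sepUCshape_of_stabilising`) ⇒ the
uniform bracket of §1 in the weight `e^{−κ'd}`.  The U5b twin of `DirectPairingRunLimit.king_U6_of_stabilising_shapes`: both consumers of
NE9 fed from ONE qualitative E-side list. [folklore] -/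
theorem uniformSmall_carriers_of_stabilising_shapes {θ C₅ B : ℝ} {Sh : Type*} (sh : T.Dom → Sh) (dS : Sh → ℝ)
    (hd : ∀ X, T.d X = dS (sh X)) (hfin : ∀ D : ℝ, {σ | dS σ ≤ D}.Finite)
    (hC : 0 ≤ C₅) (hθ0 : 0 ≤ θ) (hθ1 : θ < 1) (hκ : κ' < κ) (h5 : TowerNE5On T E I κ θ C₅)
    (hP : ∀ (k : ℕ) (U : T.B) (X : T.Dom), ∀ g ∈ BoxWindow I, ∀ g' ∈ BoxWindow I,
      (∀ i, i < k - T.r X → g i = g' i) → E k g U X = E k g' U X)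
    (hB : ∀ (k : ℕ) (U : T.B) (X : T.Dom), ∀ g ∈ BoxWindow I, Real.exp (κ * T.d X) * |E k g U X| ≤ B)
    {L : Type*} [PseudoMetricSpace L] (Kc : Sh → ℕ → Set L) (hKc : ∀ σ m, IsCompact (Kc σ m)) {a b : ℝ}
    (hI : I ⊆ Icc a b) (Em : (σ : Sh) → (m : ℕ) → ℕ → (Fin m → ℝ) → L → ℝ)
    (hcont : ∀ σ m k, ContinuousOn (fun q : (Fin m → ℝ) × L => Em σ m k q.1 q.2) ((Set.univ.pi fun _ => Icc a b) ×ˢ Kc σ m))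
    (hstab : ∀ σ m, ∀ ε : ℝ, 0 < ε → ∃ K₀ : ℕ, ∀ k, K₀ ≤ k →
      ∀ q ∈ (Set.univ.pi fun _ : Fin m => Icc a b) ×ˢ Kc σ m, |Em σ m k q.1 q.2 - Em σ m K₀ q.1 q.2| ≤ ε)
    (loc : ℕ → T.B → T.Dom → L)
    (hfac : ∀ (σ : Sh) (m k : ℕ) (U : T.B) (X : T.Dom), sh X = σ → T.r X + m = k → loc k U X ∈ Kc σ m ∧
      ∀ g ∈ BoxWindow I, Real.exp (κ * T.d X) * E k g U X = Em σ m k (fun l => g l) (loc k U X))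
    {η : ℝ} (hη : 0 < η) :
    ∃ δ : ℝ, 0 < δ ∧ ∀ (k : ℕ) (U : T.B) (X : T.Dom), T.r X ≤ k →
      ∀ g ∈ BoxWindow I, ∀ g' ∈ BoxWindow I, (∀ i, i < k - T.r X → |g i - g' i| ≤ δ) →
        |E k g U X - E k g' U X| ≤ η * Real.exp (-(κ' * T.d X)) :=
  uniformSmall_carriers_of_shapes T sh dS hd hfin hC hθ0 hθ1 hκ h5 hP hB
    (fun σ m i _ ε hε => sepUCshape_of_stabilising T sh σ m (hKc σ m) hI (Em σ m) (hcont σ m) (hstab σ m) loc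
      (hfac σ m) i ε hε) hη

/-! ## §3 The run-uniformity is load-bearing for U5b too: the run tower -/

/-- **U5b FAILS ON THE RUN TOWER** (every hypothesis of §1 except the run-uniform `hUC` in force there: `DirectPairingRunLimitSharp.towerNE5On_runTerm`,
`prefix_runTerm`, `bound_runTerm`, `perRun_sepUC_runTerm`): for `η = 1` there is NO `δ > 0` making the terms of `δ`-close histories `η·e^{−κd}`-close
uniformly in the run — the domain `n` in run `n + 1` (scale `1`) with `π∕(n+1) ≤ δ` turns the admissible discrepancy of the youngest coupling into
`|sin(3π∕2) − sin(π∕2)| = 2`. [folklore] -/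
theorem runTerm_not_uniformSmall (κ : ℝ) :
    ¬ (∃ δ : ℝ, 0 < δ ∧ ∀ (k : ℕ) (U : runTower.B) (X : runTower.Dom), runTower.r X ≤ k →
        ∀ g ∈ BoxWindow (Icc (0 : ℝ) 6), ∀ g' ∈ BoxWindow (Icc (0 : ℝ) 6), (∀ i, i < k - runTower.r X → |g i - g' i| ≤ δ) →
          |runTerm k g U X - runTerm k g' U X| ≤ 1 * Real.exp (-(κ * runTower.d X))) := by
  rintro ⟨δ, hδ, h⟩
  obtain ⟨n, hn⟩ := exists_nat_ge (Real.pi / δ)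
  obtain ⟨s1, s2, hs0, hs6⟩ := sin_pair n
  have hπ : 0 < Real.pi := Real.pi_pos
  have hn1 : (0 : ℝ) < n + 1 := by positivity
  have hstep : Real.pi / (n + 1) ≤ δ := by
    rw [div_le_iff₀ hn1]
    have h1 : Real.pi / δ * δ = Real.pi := div_mul_cancel₀ _ hδ.ne'
    nlinarith [mul_le_mul_of_nonneg_right hn hδ.le]
  set s : ℝ := Real.pi / (2 * (n + 1)) with hs
  set g : ℕ → ℝ := fun j => if j = 0 then s + Real.pi / (n + 1) else 0 with hg
  set g' : ℕ → ℝ := fun j => if j = 0 then s else 0 with hg'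
  have hq0 : (0 : ℝ) ≤ Real.pi / (n + 1) := by positivity
  have hgM : g 0 = s + Real.pi / (n + 1) := if_pos rfl
  have hg'M : g' 0 = s := if_pos rfl
  have hgj : ∀ j, j ≠ 0 → g j = 0 := fun j hj => if_neg hj
  have hg'j : ∀ j, j ≠ 0 → g' j = 0 := fun j hj => if_neg hj
  have h06 : (0 : ℝ) ∈ Icc (0 : ℝ) 6 := ⟨le_rfl, by norm_num⟩
  have hgm : g ∈ BoxWindow (Icc (0 : ℝ) 6) := fun j => by
    by_cases hj : j = 0
    · rw [hj, hgM]; exact ⟨add_nonneg hs0 hq0, hs6⟩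
    · rw [hgj j hj]; exact h06
  have hg'm : g' ∈ BoxWindow (Icc (0 : ℝ) 6) := fun j => by
    by_cases hj : j = 0
    · rw [hj, hg'M]; exact ⟨hs0, by linarith⟩
    · rw [hg'j j hj]; exact h06
  have key := h (n + 1) () n (by show n ≤ n + 1; omega) g hgm g' hg'm (fun i _ => by
    by_cases hi : i = 0
    · rw [hi, hgM, hg'M, add_sub_cancel_left, abs_of_nonneg hq0]; exact hstep
    · rw [hgj i hi, hg'j i hi, sub_self, abs_zero]; exact hδ.le)
  have hlt : n < n + 1 := Nat.lt_succ_self n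
  rw [show runTower.d n = (0 : ℝ) from rfl, mul_zero, neg_zero, Real.exp_zero, mul_one, runTerm_of_lt hlt, runTerm_of_lt hlt,
    show n + 1 - n - 1 = 0 by omega, hgM, hg'M, s2, s1] at key
  norm_num at key

end Summit.QuantumFields.BalabanUV.T4Continuum.NE9.DirectPairingUniformCarriers
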